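import Literature.AlgebraicGeometry.AbelianSchemes.AbelianSchemeLDeltaOfLambdaGlobal
import Literature.AlgebraicGeometry.AbelianSchemes.AbelianSchemeMumfordBundleClassifierAnyBase
import Literature.AlgebraicGeometry.AbelianSchemes.LDeltaRigidifiedFibrewiseAmple
import Literature.AlgebraicGeometry.AbelianSchemes.PolarizationUnitHypothesis
import HarnessLib

/-!
# `2λ = [2] ≫ λ` CLASSIFIES the Mumford family of `L^Δ(λ)`: `Λ(L^Δ(λ)) = λ·λ` read as a classifying statement
# (Mumford–Fogarty–Kirwan, GIT Ch. 6 §2 Prop. 6.10; Mumford, *Abelian Varieties*, §13)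

Layer `Literature/AlgebraicGeometry/AbelianSchemes`, namespace `Literature.AlgebraicGeometry.AbelianSchemes.AbelianSchemeOver`.
THEOREMS ONLY (no definition, no named fact, no instance, no notation, no `sorry`).  Cell `hodgecm-mathlib` (D-0151), P6 «MOD programme», road
(C1) «Θ-SPREAD» (LEAD F0P6-plan (g2) RULING «M-28′» 2026-09-01T22:52:19Z, organ **O2 «`[2] ≫ pol.lam` classifies Mumford(`L^Δ(pol)`)»**; B-p18 (g38)
census `CENSUS-C1-ThetaSpread` §C; prover seat B-p02 (g22)).  PURE ASSEMBLY of ★ Λ1 ∕ ★ Λ5 ∕ ★ rigidification — no new mathematics.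

For a polarised abelian scheme `(A, D = (Â, 𝒫), pol)` (★ `Polarization`, MFK Def. 6.3) over a CONNECTED locally Noetherian base `S`, the graph
`Gr = (1, λ) : A → A ×_S Â` of `λ := pol.lam` and `L^Δ(λ) := Gr^*𝒫` (rank one ★ `hasRank_pullback_graph_P`, rigidified ★
`Polarization.cechPic_pullback_unitSection_detClass_LDelta_eq_one`), and the unit hypothesis `hD : 𝒫|_{A × {ε_Â}} ≅ 𝒪` (★ Λ6
`Polarization.nonempty_unitHatSlice_iso` discharges it over a reduced base):

* §1 **`Polarization.mul_self_classify_mumfordBundle_LDelta`** — the `S`-homomorphism `λ·λ : A → Â` CLASSIFIES the Mumford family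
  `Λ(L^Δ(λ)) = m^*L^Δ ⊗ p₁^*(L^Δ)⁻¹ ⊗ p₂^*(L^Δ)⁻¹`: for every `S`-scheme `T` and `u : T → A`, `(1_A × (u ≫ λ·λ))^*𝒫 ≅ (A ◁ u)^*Λ(L^Δ(λ))`
  (★ `exists_isMonHom_classify_mumfordBundle`: SOME homomorphism `λ_{L^Δ}` classifies; ★ Λ5 `eq_mul_self_of_classify_mumfordBundle_LDelta`:
  `λ_{L^Δ} = λ·λ`), in both spellings (`DualPair.pullbackP` and the whisker `(A.X ◁ (u ≫ λ·λ)).left`, ★ `baseChangeToProd_eq_whiskerLeft_left`),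
  together with the kernel clause `u ∈ K(L^Δ(λ))(T) ↔ u ≫ λ·λ = 1` (★ `memKOfL_LDelta_iff_comp_mul_self_eq_one`);
* §2 the bracket spellings `λ·λ = λ ≫ [2]_Â = [2]_A ≫ λ` (`mul_self_eq_comp_sq`, `mul_self_eq_sq_comp`; Mathlib `MonObj.comp_pow` ∕
  `MonObj.pow_comp`, `[2] := (𝟙)²` in Mathlib's `Hom` monoid) and **`Polarization.sq_comp_lam_classify_mumfordBundle_LDelta`** — the head in
  the LEAD's spelling `[2] ≫ pol.lam`;
* §3 `Polarization.mul_self_classify_mumfordBundle_LDelta_of_isReduced` — the same over a REDUCED connected locally Noetherian base with `hD`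
  discharged (★ Λ6).

Consumer: O3 «classifier rigidity at the stage» (B-p18): `Λ_S(L_S)` and `[2] ≫ λ_S` both restrict to classifiers of Mumford(`L^Δ`) along the
relative leg, hence agree (★ `eq_of_classify_mumfordBundle`).  HC_CM is proved only modulo the printed citations (2 remaining named inputs hLiu418,
h413) until rung 0 closes; this file asserts nothing about HC and is count-neutral ★ capital.

## References
* [MumfordFogartyKirwan1994] D. Mumford, J. Fogarty, F. Kirwan, *Geometric Invariant Theory*, 3rd ed. (1994), Ch. 6 §2 Definition 6.2 (p. 120)
  (`Λ(L)`, `L^Δ(λ)`), Proposition 6.10 (p. 121) («`Λ(L^Δ(λ)) = 2λ`»), Definition 6.3 (p. 120) (polarization).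
* [MumfordAV1970] D. Mumford, *Abelian Varieties* (1970), §13 (pp. 123–125) (`K(L)`, `Λ(L)`), §8 (pp. 74–75).
* [MilneAV2008] J. S. Milne, *Abelian Varieties* (2008), I §8 pp. 36–37 (the dual and the Poincaré sheaf).
-/

noncomputable section

-- `TopCat.Presheaf`/`Scheme.Modules` are not reducible (as in ★ `AbelianSchemeLDeltaOfLambdaGlobal`).
set_option backward.isDefEq.respectTransparency false

open CategoryTheory CategoryTheory.Limits AlgebraicGeometry MonoidalCategory CartesianMonoidalCategory
open scoped MonObj

universe u

namespace Literature.AlgebraicGeometry.AbelianSchemes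

open Literature.AlgebraicGeometry.Motives Literature.AlgebraicGeometry.Modules

namespace AbelianSchemeOver

variable {S : Scheme.{u}} (A : AbelianSchemeOver S) (D : A.DualPair)

/-! ## §1 `λ·λ` classifies the Mumford family of `L^Δ(λ)` -/

section Classify

variable [IsLocallyNoetherian S] [PreconnectedSpace S] [Nonempty S] (pol : A.Polarization D)
  (Gr : A.X.left ⟶ A.prodLeft D.hat) (hGr₁ : Gr ≫ pullback.fst A.X.hom D.hat.X.hom = 𝟙 _)
  (hGr₂ : Gr ≫ pullback.snd A.X.hom D.hat.X.hom = pol.lam.left)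
  (hD : Nonempty ((Scheme.Modules.pullback (DualPair.unitHatSlice D)).obj D.P ≅ SheafOfModules.unit _))

include hGr₁ hGr₂ hD in
/-- **`λ·λ` CLASSIFIES THE MUMFORD FAMILY OF `L^Δ(λ)`** ([MumfordFogartyKirwan1994] Prop. 6.10 «`Λ(L^Δ(λ)) = 2λ`» as a classifying statement):
for a polarised abelian scheme `(A, (Â, 𝒫), λ)` over a connected locally Noetherian base with `𝒫|_{A × {ε_Â}} ≅ 𝒪`, and `L^Δ(λ) = Gr^*𝒫` the
pull-back of the Poincaré sheaf along the graph of `λ`: (ii) for EVERY `S`-scheme `T` and `u : T → A`,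
`(1_A × (u ≫ λ·λ))^*𝒫 ≅ (A ◁ u)^*Λ(L^Δ(λ))` (`DualPair.pullbackP` spelling), and (iii) `u ∈ K(L^Δ(λ))(T) ↔ u ≫ λ·λ = 1`.  Proof: SOME
`S`-homomorphism `λ_{L^Δ}` classifies (★ `exists_isMonHom_classify_mumfordBundle`, rigidification ★
`Polarization.cechPic_pullback_unitSection_detClass_LDelta_eq_one`), and `λ_{L^Δ} = λ·λ` (★ Λ5 `eq_mul_self_of_classify_mumfordBundle_LDelta`).
[cite: MumfordFogartyKirwan1994, Ch. 6 §2 Proposition 6.10 (p. 121) and Definition 6.2 (p. 120)] [cite: MumfordAV1970, §13 (pp. 123–125)] -/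
theorem Polarization.mul_self_classify_mumfordBundle_LDelta :
    (∀ ⦃T : Over S⦄ (u : T ⟶ A.X),
        Nonempty (D.pullbackP T.hom (u ≫ (pol.lam * pol.lam)).left (Over.w _) ≅
          (Scheme.Modules.pullback (A.X ◁ u).left).obj (A.mumfordBundle ((Scheme.Modules.pullback Gr).obj D.P)))) ∧
      ∀ ⦃T : Over S⦄ (u : T ⟶ A.X), A.MemKOfL ((Scheme.Modules.pullback Gr).obj D.P) u ↔ u ≫ (pol.lam * pol.lam) = 1 := by
  have hε := pol.cechPic_pullback_unitSection_detClass_LDelta_eq_one A Gr hGr₁ hGr₂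
    (HasRank.isFiniteLocallyFree' (hasRank_pullback Gr D.hasRank_one))
  obtain ⟨lamL, hmon, hii, hiii⟩ := A.exists_isMonHom_classify_mumfordBundle D hD (hasRank_pullback Gr D.hasRank_one) hε
  haveI := hmon
  have heq : lamL = pol.lam * pol.lam :=
    A.eq_mul_self_of_classify_mumfordBundle_LDelta D pol Gr hGr₁ hGr₂ hε lamL (fun T u => hii u)
  subst heq
  exact ⟨fun T u => hii u, fun T u => hiii u⟩

include hGr₁ hGr₂ hD in
/-- **The same in the WHISKER spelling** `(A.X ◁ (u ≫ λ·λ)).left^*𝒫 ≅ (A.X ◁ u).left^*Λ(L^Δ(λ))` (★ `baseChangeToProd_eq_whiskerLeft_left`: the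
`DualPair.pullbackP` along `(u ≫ λ·λ).left` is the pull-back along the whisker). [cite: MumfordFogartyKirwan1994, Ch. 6 §2 Proposition 6.10 (p. 121)]
[cite: MilneAV2008, I §8 pp. 36–37] -/
theorem Polarization.mul_self_classify_mumfordBundle_LDelta_whiskerLeft ⦃T : Over S⦄ (u : T ⟶ A.X) :
    Nonempty ((Scheme.Modules.pullback (A.X ◁ (u ≫ (pol.lam * pol.lam))).left).obj D.P ≅
      (Scheme.Modules.pullback (A.X ◁ u).left).obj (A.mumfordBundle ((Scheme.Modules.pullback Gr).obj D.P))) := by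
  obtain ⟨i⟩ := (pol.mul_self_classify_mumfordBundle_LDelta A D Gr hGr₁ hGr₂ hD).1 u
  exact ⟨((Scheme.Modules.pullbackCongr (A.baseChangeToProd_eq_whiskerLeft_left D.hat (u ≫ (pol.lam * pol.lam)))).app D.P).symm ≪≫ i⟩

/-! ## §2 Bracket spellings: `λ·λ = λ ≫ [2]_Â = [2]_A ≫ λ` -/

omit [IsLocallyNoetherian S] [PreconnectedSpace S] [Nonempty S] in
/-- `λ·λ = λ ≫ [2]_Â` with `[2]_Â = (𝟙 Â)²` (Mathlib `MonObj.comp_pow`; no homomorphism property needed). [cite: MumfordAV1970, §8 (pp. 74–75)] -/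
theorem Polarization.mul_self_eq_comp_sq : pol.lam * pol.lam = pol.lam ≫ ((𝟙 D.hat.X) ^ 2) := by
  rw [MonObj.comp_pow, Category.comp_id, pow_two]

omit [IsLocallyNoetherian S] [PreconnectedSpace S] [Nonempty S] in
/-- `λ·λ = [2]_A ≫ λ` with `[2]_A = (𝟙 A)²` (`λ` is a homomorphism: Mathlib `MonObj.pow_comp`). [cite: MumfordAV1970, §8 (pp. 74–75)] -/
theorem Polarization.mul_self_eq_sq_comp : pol.lam * pol.lam = ((𝟙 A.X) ^ 2) ≫ pol.lam := by
  haveI := pol.isMonHom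
  rw [MonObj.pow_comp, Category.id_comp, pow_two]

include hGr₁ hGr₂ hD in
/-- **HEAD in the LEAD's spelling — `[2] ≫ λ` CLASSIFIES `Λ(L^Δ(λ))`**: for every `S`-scheme `T` and `u : T → A`,
`(A ◁ (u ≫ [2]_A ≫ λ))^*𝒫 ≅ (A ◁ u)^*Λ(L^Δ(λ))`, and `u ∈ K(L^Δ(λ))(T) ↔ u ≫ [2]_A ≫ λ = 1` (§1 with `λ·λ = [2]_A ≫ λ`).
[cite: MumfordFogartyKirwan1994, Ch. 6 §2 Proposition 6.10 (p. 121)] [cite: MumfordAV1970, §13 (pp. 123–125)] -/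
theorem Polarization.sq_comp_lam_classify_mumfordBundle_LDelta :
    (∀ ⦃T : Over S⦄ (u : T ⟶ A.X),
        Nonempty ((Scheme.Modules.pullback (A.X ◁ (u ≫ (((𝟙 A.X) ^ 2) ≫ pol.lam))).left).obj D.P ≅
          (Scheme.Modules.pullback (A.X ◁ u).left).obj (A.mumfordBundle ((Scheme.Modules.pullback Gr).obj D.P)))) ∧
      ∀ ⦃T : Over S⦄ (u : T ⟶ A.X), A.MemKOfL ((Scheme.Modules.pullback Gr).obj D.P) u ↔ u ≫ (((𝟙 A.X) ^ 2) ≫ pol.lam) = 1 := by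
  rw [← pol.mul_self_eq_sq_comp]
  exact ⟨fun T u => pol.mul_self_classify_mumfordBundle_LDelta_whiskerLeft A D Gr hGr₁ hGr₂ hD u,
    (pol.mul_self_classify_mumfordBundle_LDelta A D Gr hGr₁ hGr₂ hD).2⟩

end Classify

/-! ## §3 Over a reduced base the unit hypothesis is automatic -/

/-- **Over a REDUCED connected locally Noetherian base**: `λ·λ` classifies `Λ(L^Δ(λ))` and `K(L^Δ(λ)) = ker (λ·λ)`, the unit hypothesis
`𝒫|_{A × {ε_Â}} ≅ 𝒪` being discharged by ★ `Polarization.nonempty_unitHatSlice_iso`. [cite: MumfordFogartyKirwan1994, Ch. 6 §2 Proposition 6.10 (p. 121) and Definition 6.3 (p. 120)] -/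
theorem Polarization.mul_self_classify_mumfordBundle_LDelta_of_isReduced [IsLocallyNoetherian S] [PreconnectedSpace S] [Nonempty S]
    [IsReduced S] (pol : A.Polarization D) (Gr : A.X.left ⟶ A.prodLeft D.hat)
    (hGr₁ : Gr ≫ pullback.fst A.X.hom D.hat.X.hom = 𝟙 _) (hGr₂ : Gr ≫ pullback.snd A.X.hom D.hat.X.hom = pol.lam.left) :
    (∀ ⦃T : Over S⦄ (u : T ⟶ A.X),
        Nonempty ((Scheme.Modules.pullback (A.X ◁ (u ≫ (pol.lam * pol.lam))).left).obj D.P ≅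
          (Scheme.Modules.pullback (A.X ◁ u).left).obj (A.mumfordBundle ((Scheme.Modules.pullback Gr).obj D.P)))) ∧
      ∀ ⦃T : Over S⦄ (u : T ⟶ A.X), A.MemKOfL ((Scheme.Modules.pullback Gr).obj D.P) u ↔ u ≫ (pol.lam * pol.lam) = 1 :=
  ⟨fun _ u => pol.mul_self_classify_mumfordBundle_LDelta_whiskerLeft A D Gr hGr₁ hGr₂ pol.nonempty_unitHatSlice_iso u,
    (pol.mul_self_classify_mumfordBundle_LDelta A D Gr hGr₁ hGr₂ pol.nonempty_unitHatSlice_iso).2⟩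

end AbelianSchemeOver

end Literature.AlgebraicGeometry.AbelianSchemes

end
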